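import Mathlib.Analysis.SpecialFunctions.Pow.Real
import Mathlib.Analysis.SpecialFunctions.Exp

/-!
# The real inequality closing the uniform Lyapunov estimate (helper for stub S2a
`stub_uniformAsymmetryTransfer`, line `fekete-usc-one-length`)

`--supports stmt-AtomisticToContinuum-11976` helper file (crux `VanishingNoiseBound`, route
`VanishingNoiseTransfer`). The proof of CEHR 2018 Theorem 5.1 for the pinned chain
(`pinnedChain_lintegral_exp_hamiltonian_small`, `LangevinChainTheorem51.lean`) ends with an
elementary real inequality ("Step 6"): the three integral bounds `X₁ + (J+1)X₂ + X₃Y^{1/q}` of the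
grid decomposition are at most `e^{θE} Bf(a) ≤ e^{θE}/2` once the explicit decay function `Bf` is
below `1/2` at the energy scale `a = E^{1/4}`. The temperature-uniform re-run of that theorem
(`…UniformLyapunov.lean`) isolates this step here, verbatim, to respect the file-size limit:

* `lyapunov_real_step` — the inequality, with all quantities real parameters.

No definitions.
-/

namespace Summit.AtomisticToContinuum.FouriersLaw.Theorems.FixedLengthNoiseContinuity

/-- **Step 6 of the proof of CEHR Theorem 5.1 (real arithmetic).** With `a⁴ = E`,
`0 ≤ J ≤ t⋆a/Λ₀`, `0 < τ ≤ 2Λ₀/a`, `τ ≤ (m₁a)²/2`, `u₂ = 2τ²/((m₁a)² - τ)²` and the decay function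
`Bf(a) < 1/2`:
`e^{-κγε₁t⋆E} e^{θE + C t⋆} + (J+1) e^{Ct⋆} e^{θE/2} + e^{Ct⋆}e^{θE}((J+1)e^{-3θE/2}e^{Ct⋆}e^{θE} + 2Ju₂)^{1/q} ≤ e^{θE}/2`
(adapted verbatim from `pinnedChain_lintegral_exp_hamiltonian_small`, Literature/…/LangevinChainTheorem51.lean). -/
theorem lyapunov_real_step {θ E a tstar Λ₀ κ γ ε₁ Cst m₁ q J τ u₂ : ℝ}
    (hq0 : 0 < 1 / q) (hts : 0 < tstar) (hΛ₀ : 0 < Λ₀) (hm₁0 : 0 < m₁) (ha0 : 0 < a)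
    (hτ0 : 0 < τ) (hτ2 : τ ≤ 2 * Λ₀ / a) (hτsmall : τ ≤ (m₁ * a) ^ 2 / 2)
    (ha4 : a ^ 4 = E) (hJ0 : 0 ≤ J) (hJr : J ≤ tstar / Λ₀ * a)
    (hu₂ : u₂ = 2 * τ ^ 2 / ((m₁ * a) ^ 2 - τ) ^ 2)
    (hBa : Real.exp (Cst * tstar) * Real.exp (-(κ * γ * ε₁ * tstar * a ^ 4)) +
      (tstar / Λ₀ * a + 1) * Real.exp (Cst * tstar) * Real.exp (-(θ / 2 * a ^ 4)) +
      Real.exp (Cst * tstar) * ((tstar / Λ₀ * a + 1) * Real.exp (Cst * tstar) * Real.exp (-(θ / 2 * a ^ 4)) +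
        (64 * Λ₀ * tstar / m₁ ^ 4) * (a ^ 5)⁻¹) ^ (1 / q) < 1 / 2) :
    Real.exp (-(κ * (γ * ε₁ * tstar * E))) * Real.exp (θ * E + Cst * tstar) +
      (J + 1) * (Real.exp (Cst * tstar) * Real.exp (θ * E / 2)) +
      Real.exp (Cst * tstar) * Real.exp (θ * E) *
        ((J + 1) * (Real.exp (-(θ * (3 * E / 2))) * (Real.exp (Cst * tstar) * Real.exp (θ * E))) +
          J * (2 * u₂)) ^ (1 / q) ≤ Real.exp (θ * E) / 2 := by
  -- adapted from Step 6 of `pinnedChain_lintegral_exp_hamiltonian_small`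
  set X₁ : ℝ := Real.exp (-(κ * (γ * ε₁ * tstar * E))) * Real.exp (θ * E + Cst * tstar) with hX₁
  set X₂ : ℝ := Real.exp (Cst * tstar) * Real.exp (θ * E / 2) with hX₂
  set X₃ : ℝ := Real.exp (Cst * tstar) * Real.exp (θ * E) with hX₃
  set u₁ : ℝ := Real.exp (-(θ * (3 * E / 2))) * (Real.exp (Cst * tstar) * Real.exp (θ * E)) with hu₁
  set Y : ℝ := (J + 1) * u₁ + J * (2 * u₂) with hY
  have hu₂0 : 0 ≤ u₂ := by rw [hu₂]; positivity
  have hY0 : 0 ≤ Y := by positivity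
  set Bf : ℝ := Real.exp (Cst * tstar) * Real.exp (-(κ * γ * ε₁ * tstar * a ^ 4)) +
      (tstar / Λ₀ * a + 1) * Real.exp (Cst * tstar) * Real.exp (-(θ / 2 * a ^ 4)) +
      Real.exp (Cst * tstar) * ((tstar / Λ₀ * a + 1) * Real.exp (Cst * tstar) * Real.exp (-(θ / 2 * a ^ 4)) +
        (64 * Λ₀ * tstar / m₁ ^ 4) * (a ^ 5)⁻¹) ^ (1 / q) with hBf
  have hEexp : Real.exp (θ * E) * Real.exp (-(θ / 2 * a ^ 4)) = Real.exp (θ * E / 2) := by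
    rw [← Real.exp_add, ha4]; congr 1; ring
  have hterm1 : X₁ = Real.exp (θ * E) * (Real.exp (Cst * tstar) * Real.exp (-(κ * γ * ε₁ * tstar * a ^ 4))) := by
    rw [hX₁, ← ha4, Real.exp_add]
    have : -(κ * (γ * ε₁ * tstar * a ^ 4)) = -(κ * γ * ε₁ * tstar * a ^ 4) := by ring
    rw [this]; ring
  have hterm2 : (J + 1) * X₂ ≤ Real.exp (θ * E) * ((tstar / Λ₀ * a + 1) * Real.exp (Cst * tstar) *
      Real.exp (-(θ / 2 * a ^ 4))) := by
    rw [hX₂, ← hEexp]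
    have h0 : 0 ≤ Real.exp (Cst * tstar) * (Real.exp (θ * E) * Real.exp (-(θ / 2 * a ^ 4))) := by positivity
    calc (J + 1) * (Real.exp (Cst * tstar) * (Real.exp (θ * E) * Real.exp (-(θ / 2 * a ^ 4))))
        ≤ (tstar / Λ₀ * a + 1) * (Real.exp (Cst * tstar) * (Real.exp (θ * E) * Real.exp (-(θ / 2 * a ^ 4)))) :=
          mul_le_mul_of_nonneg_right (by linarith only [hJr]) h0
      _ = _ := by ring
  have hu₂_le : u₂ ≤ 32 * Λ₀ ^ 2 / (m₁ ^ 4 * a ^ 6) := by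
    rw [hu₂]
    have hden : (m₁ * a) ^ 2 / 2 ≤ (m₁ * a) ^ 2 - τ := by linarith only [hτsmall]
    have hden0 : 0 < (m₁ * a) ^ 2 / 2 := by positivity
    have h1 : 2 * τ ^ 2 / ((m₁ * a) ^ 2 - τ) ^ 2 ≤ 2 * τ ^ 2 / ((m₁ * a) ^ 2 / 2) ^ 2 := by
      refine div_le_div_of_nonneg_left (by positivity) (by positivity) ?_
      exact pow_le_pow_left₀ hden0.le hden 2
    refine h1.trans ?_
    have hτ2' : τ ^ 2 ≤ (2 * Λ₀ / a) ^ 2 := pow_le_pow_left₀ hτ0.le hτ2 2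
    rw [div_le_div_iff₀ (by positivity) (by positivity)]
    have : 2 * τ ^ 2 * (m₁ ^ 4 * a ^ 6) ≤ 2 * (2 * Λ₀ / a) ^ 2 * (m₁ ^ 4 * a ^ 6) :=
      mul_le_mul_of_nonneg_right (by linarith only [hτ2']) (by positivity)
    refine this.trans (le_of_eq ?_)
    field_simp
    ring
  have hY_le : Y ≤ (tstar / Λ₀ * a + 1) * Real.exp (Cst * tstar) * Real.exp (-(θ / 2 * a ^ 4)) +
      (64 * Λ₀ * tstar / m₁ ^ 4) * (a ^ 5)⁻¹ := by
    rw [hY]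
    refine add_le_add ?_ ?_
    · rw [hu₁]
      have he : Real.exp (-(θ * (3 * E / 2))) * (Real.exp (Cst * tstar) * Real.exp (θ * E)) =
          Real.exp (Cst * tstar) * Real.exp (-(θ / 2 * a ^ 4)) := by
        rw [← ha4, mul_comm, mul_assoc, ← Real.exp_add]; congr 1; ring_nf
      rw [he]
      have h0 : 0 ≤ Real.exp (Cst * tstar) * Real.exp (-(θ / 2 * a ^ 4)) := by positivity
      calc (J + 1) * (Real.exp (Cst * tstar) * Real.exp (-(θ / 2 * a ^ 4)))
          ≤ (tstar / Λ₀ * a + 1) * (Real.exp (Cst * tstar) * Real.exp (-(θ / 2 * a ^ 4))) :=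
            mul_le_mul_of_nonneg_right (by linarith only [hJr]) h0
        _ = _ := by ring
    · calc J * (2 * u₂) ≤ (tstar / Λ₀ * a) * (2 * (32 * Λ₀ ^ 2 / (m₁ ^ 4 * a ^ 6))) :=
            mul_le_mul hJr (by linarith only [hu₂_le]) (by positivity) (by positivity)
        _ = (64 * Λ₀ * tstar / m₁ ^ 4) * (a ^ 5)⁻¹ := by field_simp; ring
  have hterm3 : X₃ * Y ^ (1 / q) ≤ Real.exp (θ * E) * (Real.exp (Cst * tstar) *
      ((tstar / Λ₀ * a + 1) * Real.exp (Cst * tstar) * Real.exp (-(θ / 2 * a ^ 4)) +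
        (64 * Λ₀ * tstar / m₁ ^ 4) * (a ^ 5)⁻¹) ^ (1 / q)) := by
    rw [hX₃]
    have hrp := Real.rpow_le_rpow hY0 hY_le hq0.le
    calc Real.exp (Cst * tstar) * Real.exp (θ * E) * Y ^ (1 / q)
        ≤ Real.exp (Cst * tstar) * Real.exp (θ * E) * ((tstar / Λ₀ * a + 1) * Real.exp (Cst * tstar) *
            Real.exp (-(θ / 2 * a ^ 4)) + (64 * Λ₀ * tstar / m₁ ^ 4) * (a ^ 5)⁻¹) ^ (1 / q) :=
          mul_le_mul_of_nonneg_left hrp (by positivity)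
      _ = _ := by ring
  have hfinal : X₁ + (J + 1) * X₂ + X₃ * Y ^ (1 / q) ≤ Real.exp (θ * E) * Bf := by
    rw [hterm1, hBf]
    nlinarith only [hterm2, hterm3, Real.exp_pos (θ * E)]
  have hhalf : Real.exp (θ * E) * Bf ≤ Real.exp (θ * E) / 2 := by
    have := hBa.le
    nlinarith only [this, Real.exp_pos (θ * E)]
  exact hfinal.trans hhalf

/-- Registered helper sub-goal `helper_uniformLyapunovArith` of stmt-AtomisticToContinuum-11976
(= `lyapunov_real_step`, fully quantified one-line form). -/
theorem helper_uniformLyapunovArith : ∀ (θ E a tstar Λ₀ κ γ ε₁ Cst m₁ q J τ u₂ : ℝ), 0 < 1 / q → 0 < tstar → 0 < Λ₀ → 0 < m₁ → 0 < a → 0 < τ → τ ≤ 2 * Λ₀ / a → τ ≤ (m₁ * a) ^ 2 / 2 → a ^ 4 = E → 0 ≤ J → J ≤ tstar / Λ₀ * a → u₂ = 2 * τ ^ 2 / ((m₁ * a) ^ 2 - τ) ^ 2 → Real.exp (Cst * tstar) * Real.exp (-(κ * γ * ε₁ * tstar * a ^ 4)) + (tstar / Λ₀ * a + 1) * Real.exp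 (Cst * tstar) * Real.exp (-(θ / 2 * a ^ 4)) + Real.exp (Cst * tstar) * ((tstar / Λ₀ * a + 1) * Real.exp (Cst * tstar) * Real.exp (-(θ / 2 * a ^ 4)) + (64 * Λ₀ * tstar / m₁ ^ 4) * (a ^ 5)⁻¹) ^ (1 / q) < 1 / 2 → Real.exp (-(κ * (γ * ε₁ * tstar * E))) * Real.exp (θ * E + Cst * tstar) + (J + 1) * (Real.exp (Cst * tstar) * Real.exp (θ * E / 2)) + Real.exp (Cst * tstar) * Real.exp (θ * E) * ((J + 1) * (Real.exp (-(θ * (3 * E / 2))) * (Real.exp (Cst * tstar) * Real.exp (θ * E))) + J * (2 * u₂)) ^ (1 / q) ≤ Real.exp (θ * E) / 2 :=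
  fun _ _ _ _ _ _ _ _ _ _ _ _ _ _ hq0 hts hΛ₀ hm₁0 ha0 hτ0 hτ2 hτsmall ha4 hJ0 hJr hu₂ hBa =>
    lyapunov_real_step hq0 hts hΛ₀ hm₁0 ha0 hτ0 hτ2 hτsmall ha4 hJ0 hJr hu₂ hBa

end Summit.AtomisticToContinuum.FouriersLaw.Theorems.FixedLengthNoiseContinuity
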